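import Literature.Probability.LatticeModels.StrongHarrisKleitman
import Mathlib.Tactic.Linarith
import Mathlib.Tactic.Ring
import Mathlib.Tactic.Positivity
import HarnessLib

/-!
# `NoHeavyLowerTail` (crux stmt-CriticalPhenomena-4575), master-family line P1 (gen 11):
# Gladkov's strong Harris–Kleitman inequality WITH A FREE REGION —
# `μ(U) μ(D) − μ(U ∩ D) ≥ e₂(μ P₁, …, μ P_k)` for an up-set `U`, a down-set `D`, and pairwise
# incomparable parts `P_i` covering `U ∩ D`

Support file (seat `prim-masterthm-p1`, gen 11; `--supports stmt-CriticalPhenomena-4575`).  No definition, no `sorry`,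
standard axioms.  Memo `run/shared/lean/prim/prim-masterthm/FROM-prim-masterthm-p1-g11-ALL-ORDERS.md` §2.  Companion of
`…HarrisTwoIncomparableParts` (the case `k = 2`, landed first) and of the tree's formalisation of Gladkov 2024, Thm. 2.1
(`Literature.Probability.LatticeModels.prodBernoulli_strongHarris`), whose section machinery is reused.

THEOREM (`prodBernoulli_strongHarris_freeRegion`).  `μ = prodBernoulli p` on `Set ι` (finite `ι`, or cylinder events).
Let `U` be closed upwards, `D` closed downwards, and let `U ∩ D ⊆ ⋃_{i∈s} P i` with the `P i ⊆ U ∩ D` (`i ∈ s`) pairwise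
disjoint and pairwise INCOMPARABLE (no configuration of `P i` is contained in one of `P j`, `i ≠ j`).  Then

  `(Σ_i μ(P i))² − Σ_i μ(P i)² ≤ 2 ( μ(U) μ(D) − μ(U ∩ D) )`,  i.e.  `μ(U) μ(D) ≥ μ(U ∩ D) + e₂(μ P)`.

Gladkov's Theorem 2.1 is the case `U ∪ D = univ` (`U = A ∪ ⋃ C_i`, `D = B ∪ ⋃ C_i`; then `μUμD − μ(U∩D) = μAμB` because
`μA + μB + Σ μC_i = 1`) — the tree's `prodBernoulli_strongHarris` (not restated).  In general the sixth region `(U ∪ D)ᶜ` is free and the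
statement is strictly stronger than Theorem 2.1 applied to any admissible repartition (memo §2).  Typical instance: for an
antichain `𝒜` and ANY partition of it, `μ(↑𝒜) μ(↓𝒜) ≥ μ(𝒜) + e₂(block masses)`.  This is the degree-2 part of the seat's
all-orders convex-set conjecture `μ(U) μ(D) ≥ ∏_i (1 + μ P_i) − 1` (memo §1), whose degree-3 part contains the co-sunflower
class law.

PROOF = Gladkov's coordinate induction verbatim, once the right bookkeeping is in place: along a coordinate `e`, with
`m_i = μ(P_i¹ ∖ P_i⁰)`, `ℓ_i = μ(P_i⁰ ∖ P_i¹)`, the inclusions `P_i⁰ ∖ P_i¹ ⊆ D⁰ ∖ D¹`, `P_i¹ ∖ P_i⁰ ⊆ U¹ ∖ U⁰` (pairwise disjoint in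
`i`) give `μU⁰ + Σ m_i ≤ μU¹`, `μD¹ + Σ ℓ_i ≤ μD⁰`, and the defect is a concave quadratic in `p_e` (`step_arith`, the tree's
`StrongHarris.step_arith` with `2ab` replaced by `2(ud − n)`). [this work]
-/

noncomputable section

namespace Summit.CriticalPhenomena.PercolationContinuityZ3.Theorems

namespace StrongHarrisFreeRegion

open MeasureTheory Measure Literature.Probability.Percolation Literature.Probability.LatticeModels
  Literature.Probability.LatticeModels.StrongHarris
open scoped ENNReal

variable {ι : Type*}

/-! ### The arithmetic of the induction step -/

/-- **Induction step, as real arithmetic** (Gladkov's concavity argument with the target `2(ud − n)`).  With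
`c¹_i = w_i + m_i`, `c⁰_i = w_i + ℓ_i` (`m, ℓ ≥ 0`), `u₀ + Σ m ≤ u₁`, `d₁ + Σ ℓ ≤ d₀`, and the induction hypotheses
`(Σ c¹)² − Σ (c¹)² ≤ 2(u₁d₁ − n₁)`, `(Σ c⁰)² − Σ (c⁰)² ≤ 2(u₀d₀ − n₀)`, every convex combination with weight `p ∈ [0,1]`
satisfies `(Σ c)² − Σ c² ≤ 2(ud − n)`. [cite: Gladkov2024StrongFKG, proof of Thm. 2.1 (the quadratic-in-`p` argument)] -/
theorem step_arith {κ : Type*} (s : Finset κ) {p u₁ u₀ d₁ d₀ n₁ n₀ : ℝ} {w m l : κ → ℝ}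
    (hp0 : 0 ≤ p) (hp1 : p ≤ 1) (hm : ∀ i ∈ s, 0 ≤ m i) (hl : ∀ i ∈ s, 0 ≤ l i)
    (hu : u₀ + ∑ i ∈ s, m i ≤ u₁) (hd : d₁ + ∑ i ∈ s, l i ≤ d₀)
    (ih₁ : (∑ i ∈ s, (w i + m i)) ^ 2 - ∑ i ∈ s, (w i + m i) ^ 2 ≤ 2 * (u₁ * d₁ - n₁))
    (ih₀ : (∑ i ∈ s, (w i + l i)) ^ 2 - ∑ i ∈ s, (w i + l i) ^ 2 ≤ 2 * (u₀ * d₀ - n₀)) :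
    (∑ i ∈ s, (p * (w i + m i) + (1 - p) * (w i + l i))) ^ 2
        - ∑ i ∈ s, (p * (w i + m i) + (1 - p) * (w i + l i)) ^ 2 ≤
      2 * ((p * u₁ + (1 - p) * u₀) * (p * d₁ + (1 - p) * d₀) - (p * n₁ + (1 - p) * n₀)) := by
  set C₁ := ∑ i ∈ s, (w i + m i) with hC₁
  set C₀ := ∑ i ∈ s, (w i + l i) with hC₀
  set S₁₁ := ∑ i ∈ s, (w i + m i) ^ 2 with hS₁₁
  set S₀₀ := ∑ i ∈ s, (w i + l i) ^ 2 with hS₀₀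
  set S₁₀ := ∑ i ∈ s, (w i + m i) * (w i + l i) with hS₁₀
  set T := ∑ i ∈ s, l i with hT
  set W := ∑ i ∈ s, m i with hW
  have e1 : ∑ i ∈ s, (p * (w i + m i) + (1 - p) * (w i + l i)) = p * C₁ + (1 - p) * C₀ := by
    rw [hC₁, hC₀, Finset.mul_sum, Finset.mul_sum, ← Finset.sum_add_distrib]
  have e2 : ∑ i ∈ s, (p * (w i + m i) + (1 - p) * (w i + l i)) ^ 2 =
      p ^ 2 * S₁₁ + 2 * p * (1 - p) * S₁₀ + (1 - p) ^ 2 * S₀₀ := by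
    rw [hS₁₁, hS₁₀, hS₀₀, Finset.mul_sum, Finset.mul_sum, Finset.mul_sum,
      ← Finset.sum_add_distrib, ← Finset.sum_add_distrib]
    exact Finset.sum_congr rfl fun i _ => by ring
  have e3 : C₁ - C₀ = W - T := by
    rw [hC₁, hC₀, hW, hT, ← Finset.sum_sub_distrib, ← Finset.sum_sub_distrib]
    exact Finset.sum_congr rfl fun i _ => by ring
  have e4 : S₁₁ - 2 * S₁₀ + S₀₀ = ∑ i ∈ s, (m i - l i) ^ 2 := by
    rw [hS₁₁, hS₁₀, hS₀₀, Finset.mul_sum, ← Finset.sum_sub_distrib, ← Finset.sum_add_distrib]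
    exact Finset.sum_congr rfl fun i _ => by ring
  have h5 : ∑ i ∈ s, (m i - l i) ^ 2 ≤ W ^ 2 + T ^ 2 := by
    calc ∑ i ∈ s, (m i - l i) ^ 2 ≤ ∑ i ∈ s, (m i ^ 2 + l i ^ 2) :=
          Finset.sum_le_sum fun i hi => by nlinarith [hm i hi, hl i hi]
      _ = ∑ i ∈ s, m i ^ 2 + ∑ i ∈ s, l i ^ 2 := Finset.sum_add_distrib
      _ ≤ W ^ 2 + T ^ 2 := add_le_add (sum_sq_le_sq_sum s m hm) (sum_sq_le_sq_sum s l hl)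
  have hT0 : 0 ≤ T := Finset.sum_nonneg hl
  have hW0 : 0 ≤ W := Finset.sum_nonneg hm
  set G := -2 * ((u₁ - u₀) * (d₁ - d₀)) + (C₁ - C₀) ^ 2 - (S₁₁ - 2 * S₁₀ + S₀₀) with hG
  have hG0 : 0 ≤ G := by
    have h6 : W * T ≤ (u₁ - u₀) * (d₀ - d₁) := mul_le_mul (by linarith) (by linarith) hT0 (by linarith)
    rw [hG, e3, e4]
    nlinarith [h5, h6]
  have key : 2 * ((p * u₁ + (1 - p) * u₀) * (p * d₁ + (1 - p) * d₀) - (p * n₁ + (1 - p) * n₀)) -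
      ((p * C₁ + (1 - p) * C₀) ^ 2 - (p ^ 2 * S₁₁ + 2 * p * (1 - p) * S₁₀ + (1 - p) ^ 2 * S₀₀)) =
      p * (2 * (u₁ * d₁ - n₁) - (C₁ ^ 2 - S₁₁)) + (1 - p) * (2 * (u₀ * d₀ - n₀) - (C₀ ^ 2 - S₀₀)) +
        p * (1 - p) * G := by
    rw [hG]; ring
  rw [e1, e2]
  have h7 : 0 ≤ p * (2 * (u₁ * d₁ - n₁) - (C₁ ^ 2 - S₁₁)) := mul_nonneg hp0 (by linarith)
  have h8 : 0 ≤ (1 - p) * (2 * (u₀ * d₀ - n₀) - (C₀ ^ 2 - S₀₀)) := mul_nonneg (by linarith) (by linarith)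
  have h9 : 0 ≤ p * (1 - p) * G := mul_nonneg (mul_nonneg hp0 (by linarith)) hG0
  linarith [key, h7, h8, h9]

/-! ### The induction on the set of coordinates -/

/-- **The core statement**, by induction on the finite coordinate set `F`: for cylinder events `U` (up), `D` (down) and
parts `P i ⊆ U ∩ D` (`i ∈ s`), pairwise disjoint, pairwise incomparable, covering `U ∩ D`:
`(Σ μ P_i)² − Σ (μ P_i)² ≤ 2(μU μD − μ(U ∩ D))`. [this work] -/
theorem core [DecidableEq ι] (p : ι → unitInterval) {κ : Type*} (s : Finset κ) (F : Finset ι) :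
    ∀ (U D : Set (Set ι)) (P : κ → Set (Set ι)), IsUpperSet U → IsLowerSet D →
      (∀ i ∈ s, P i ⊆ U ∩ D) → (∀ i ∈ s, ∀ j ∈ s, i ≠ j → Disjoint (P i) (P j)) →
      (∀ ω ∈ U ∩ D, ∃ i ∈ s, ω ∈ P i) →
      (∀ i ∈ s, ∀ j ∈ s, i ≠ j → ∀ ω ∈ P i, ∀ ω' ∈ P j, ¬ ω ⊆ ω') →
      DeterminedBy U (↑F : Set ι) → DeterminedBy D (↑F : Set ι) → (∀ i ∈ s, DeterminedBy (P i) (↑F : Set ι)) →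
      (∑ i ∈ s, (prodBernoulli p).real (P i)) ^ 2 - ∑ i ∈ s, (prodBernoulli p).real (P i) ^ 2 ≤
        2 * ((prodBernoulli p).real U * (prodBernoulli p).real D - (prodBernoulli p).real (U ∩ D)) := by
  set μ := prodBernoulli p with hμ
  induction F using Finset.induction_on with
  | empty =>
    intro U D P hU hD hP hdisj hcov hinc dU dD dP
    have triv : ∀ X : Set (Set ι), DeterminedBy X (↑(∅ : Finset ι) : Set ι) →
        μ.real X = 0 ∨ μ.real X = 1 := by
      intro X hX
      rw [determinedBy_iff] at hX
      by_cases hne : X.Nonempty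
      · obtain ⟨ω₀, hω₀⟩ := hne
        have : X = Set.univ := Set.eq_univ_of_forall fun ω => (hX ω ω₀ (by simp)).2 hω₀
        exact Or.inr (by rw [this, probReal_univ])
      · exact Or.inl (by rw [Set.not_nonempty_iff_eq_empty.1 hne, measureReal_empty])
    -- each `μ(P i)` is `0` or `1`, so `Σ μ(P i)² = Σ μ(P i)`; and `Σ μ(P i) ≤ μ(U ∩ D) ≤ 1`
    have hsq : ∑ i ∈ s, μ.real (P i) ^ 2 = ∑ i ∈ s, μ.real (P i) :=
      Finset.sum_congr rfl fun i hi => by rcases triv (P i) (dP i hi) with h | h <;> simp [h]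
    have mP : ∀ i ∈ s, MeasurableSet (P i) := fun i hi => (dP i hi).measurableSet_of_finset
    have hle : ∑ i ∈ s, μ.real (P i) ≤ μ.real (U ∩ D) := by
      rw [← measureReal_biUnion_finset (μ := μ)
        (fun i hi j hj hij => hdisj i (Finset.mem_coe.1 hi) j (Finset.mem_coe.1 hj) hij)
        mP (fun i _ => measure_ne_top _ _)]
      exact measureReal_mono (Set.iUnion₂_subset fun i hi => hP i hi) (measure_ne_top _ _)
    have hm1 : μ.real (U ∩ D) ≤ 1 :=
      (measureReal_mono (Set.subset_univ _) (measure_ne_top _ _)).trans_eq probReal_univ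
    have hmU : μ.real (U ∩ D) ≤ μ.real U := measureReal_mono Set.inter_subset_left (measure_ne_top _ _)
    have hmD : μ.real (U ∩ D) ≤ μ.real D := measureReal_mono Set.inter_subset_right (measure_ne_top _ _)
    have h0 : 0 ≤ ∑ i ∈ s, μ.real (P i) := Finset.sum_nonneg fun i _ => measureReal_nonneg
    have hm0 : 0 ≤ μ.real (U ∩ D) := measureReal_nonneg
    have hD0 : 0 ≤ μ.real D := measureReal_nonneg
    rw [hsq]
    -- `μ U ∈ {0,1}`: if `0` everything vanishes, if `1` then `μUμD − μ(U∩D) = μD − μ(U∩D) ≥ 0`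
    rcases triv U dU with hx | hx
    · have hm : μ.real (U ∩ D) = 0 := le_antisymm (by linarith) hm0
      have hS : ∑ i ∈ s, μ.real (P i) = 0 := le_antisymm (by linarith) h0
      rw [hS, hm, hx]; simp
    · rw [hx]; nlinarith [hle, h0, hm1, hmD]
  | insert e F' he ih =>
    intro U D P hU hD hP hdisj hcov hinc dU dD dP
    -- the sections
    set U₁ := insert e ⁻¹' U with hU₁d
    set U₀ := (· \ {e}) ⁻¹' U with hU₀d
    set D₁ := insert e ⁻¹' D with hD₁d
    set D₀ := (· \ {e}) ⁻¹' D with hD₀d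
    set P₁ : κ → Set (Set ι) := fun i => insert e ⁻¹' P i with hP₁d
    set P₀ : κ → Set (Set ι) := fun i => (· \ {e}) ⁻¹' P i with hP₀d
    have hle : ∀ ω : Set ι, ω \ {e} ⊆ insert e ω := fun ω =>
      (Set.sdiff_subset).trans (Set.subset_insert e ω)
    have mono_ins : ∀ ω ω' : Set ι, ω ⊆ ω' → insert e ω ⊆ insert e ω' := fun ω ω' h =>
      Set.insert_subset_insert h
    have mono_del : ∀ ω ω' : Set ι, ω ⊆ ω' → ω \ {e} ⊆ ω' \ {e} := fun ω ω' h x hx =>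
      ⟨h hx.1, hx.2⟩
    -- determinacy, measurability
    have dU₁ : DeterminedBy U₁ (↑F' : Set ι) := determinedBy_preimage_insert dU
    have dU₀ : DeterminedBy U₀ (↑F' : Set ι) := determinedBy_preimage_sdiff dU
    have dD₁ : DeterminedBy D₁ (↑F' : Set ι) := determinedBy_preimage_insert dD
    have dD₀ : DeterminedBy D₀ (↑F' : Set ι) := determinedBy_preimage_sdiff dD
    have dP₁ : ∀ i ∈ s, DeterminedBy (P₁ i) (↑F' : Set ι) := fun i hi => determinedBy_preimage_insert (dP i hi)
    have dP₀ : ∀ i ∈ s, DeterminedBy (P₀ i) (↑F' : Set ι) := fun i hi => determinedBy_preimage_sdiff (dP i hi)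
    have mU₀ : MeasurableSet U₀ := dU₀.measurableSet_of_finset
    have mD₁ : MeasurableSet D₁ := dD₁.measurableSet_of_finset
    have mP₁ : ∀ i ∈ s, MeasurableSet (P₁ i) := fun i hi => (dP₁ i hi).measurableSet_of_finset
    have mP₀ : ∀ i ∈ s, MeasurableSet (P₀ i) := fun i hi => (dP₀ i hi).measurableSet_of_finset
    -- order structure of the sections
    have hU₁up : IsUpperSet U₁ := isUpperSet_preimage_insert hU
    have hU₀up : IsUpperSet U₀ := isUpperSet_preimage_sdiff hU
    have hD₁lo : IsLowerSet D₁ := fun ω ω' h hω => hD (mono_ins ω' ω h) hω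
    have hD₀lo : IsLowerSet D₀ := fun ω ω' h hω => hD (mono_del ω' ω h) hω
    -- the induction hypotheses for the two section systems
    have ih₁ := ih U₁ D₁ P₁ hU₁up hD₁lo (fun i hi ω h => hP i hi h)
      (fun i hi j hj hij => (hdisj i hi j hj hij).preimage _) (fun ω h => hcov _ h)
      (fun i hi j hj hij ω hω ω' hω' h => hinc i hi j hj hij _ hω _ hω' (mono_ins ω ω' h)) dU₁ dD₁ dP₁
    have ih₀ := ih U₀ D₀ P₀ hU₀up hD₀lo (fun i hi ω h => hP i hi h)
      (fun i hi j hj hij => (hdisj i hi j hj hij).preimage _) (fun ω h => hcov _ h)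
      (fun i hi j hj hij ω hω ω' hω' h => hinc i hi j hj hij _ hω _ hω' (mono_del ω ω' h)) dU₀ dD₀ dP₀
    -- nesting of the sections of `U` and `D`
    have hU₀₁ : U₀ ⊆ U₁ := fun ω hω => hU (hle ω) hω
    have hD₁₀ : D₁ ⊆ D₀ := fun ω hω => hD (hle ω) hω
    -- the key inclusions
    have kP₀ : ∀ i ∈ s, P₀ i \ P₁ i ⊆ D₀ \ D₁ := by
      intro i hi ω hω
      refine ⟨(hP i hi hω.1).2, fun hD₁' => ?_⟩
      have hU₁' : insert e ω ∈ U := hU (hle ω) (hP i hi hω.1).1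
      obtain ⟨j, hj, hωj⟩ := hcov _ ⟨hU₁', hD₁'⟩
      by_cases hij : i = j
      · subst hij; exact hω.2 hωj
      · exact hinc i hi j hj hij _ hω.1 _ hωj (hle ω)
    have kP₁ : ∀ i ∈ s, P₁ i \ P₀ i ⊆ U₁ \ U₀ := by
      intro i hi ω hω
      refine ⟨(hP i hi hω.1).1, fun hU₀' => ?_⟩
      have hD₀' : ω \ {e} ∈ D := hD (hle ω) (hP i hi hω.1).2
      obtain ⟨j, hj, hωj⟩ := hcov _ ⟨hU₀', hD₀'⟩
      by_cases hij : i = j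
      · subst hij; exact hω.2 hωj
      · exact hinc j hj i hi (Ne.symm hij) _ hωj _ hω.1 (hle ω)
    -- the pieces: `w_i = μ(P¹ ∩ P⁰)`, `m_i = μ(P¹ ∖ P⁰)`, `ℓ_i = μ(P⁰ ∖ P¹)`
    set w : κ → ℝ := fun i => μ.real (P₁ i ∩ P₀ i) with hw
    set m : κ → ℝ := fun i => μ.real (P₁ i \ P₀ i) with hmdef
    set l : κ → ℝ := fun i => μ.real (P₀ i \ P₁ i) with hldef
    have split : ∀ (X Y : Set (Set ι)), MeasurableSet X → MeasurableSet Y →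
        μ.real X = μ.real (X ∩ Y) + μ.real (X \ Y) := by
      intro X Y mX mY
      have hd' : Disjoint (X ∩ Y) (X \ Y) := Set.disjoint_left.2 fun ω h1 h2 => h2.2 h1.2
      have hset : X ∩ Y ∪ X \ Y = X := by
        ext ω; constructor
        · rintro (h | h)
          · exact h.1
          · exact h.1
        · intro h
          by_cases hY : ω ∈ Y
          · exact Or.inl ⟨h, hY⟩
          · exact Or.inr ⟨h, hY⟩
      rw [← measureReal_union hd' (mX.diff mY) (measure_ne_top _ _) (measure_ne_top _ _), hset]
    have hc₁ : ∀ i ∈ s, μ.real (P₁ i) = w i + m i := fun i hi => split _ _ (mP₁ i hi) (mP₀ i hi)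
    have hc₀ : ∀ i ∈ s, μ.real (P₀ i) = w i + l i := fun i hi => by
      simp only [hw, hldef]; rw [Set.inter_comm]; exact split _ _ (mP₀ i hi) (mP₁ i hi)
    -- `μ(U⁰) + Σ m_i ≤ μ(U¹)`
    have hu : μ.real U₀ + ∑ i ∈ s, m i ≤ μ.real U₁ := by
      have hsub : U₀ ∪ ⋃ i ∈ s, (P₁ i \ P₀ i) ⊆ U₁ :=
        Set.union_subset hU₀₁ (Set.iUnion₂_subset fun i hi ω h => (kP₁ i hi h).1)
      have hpd : (↑s : Set κ).PairwiseDisjoint fun i => P₁ i \ P₀ i :=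
        fun i hi j hj hij => Set.disjoint_left.2 fun ω h1 h2 =>
          Set.disjoint_left.1 ((hdisj i (Finset.mem_coe.1 hi) j (Finset.mem_coe.1 hj) hij).preimage _) h1.1 h2.1
      have hd0 : Disjoint U₀ (⋃ i ∈ s, (P₁ i \ P₀ i)) := by
        refine Set.disjoint_left.2 fun ω h1 h2 => ?_
        simp only [Set.mem_iUnion, exists_prop] at h2
        obtain ⟨i, hi, h3⟩ := h2
        exact (kP₁ i hi h3).2 h1
      have hmU : MeasurableSet (⋃ i ∈ s, (P₁ i \ P₀ i)) :=
        Finset.measurableSet_biUnion s fun i hi => (mP₁ i hi).diff (mP₀ i hi)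
      calc μ.real U₀ + ∑ i ∈ s, m i
          = μ.real (U₀ ∪ ⋃ i ∈ s, (P₁ i \ P₀ i)) := by
            rw [measureReal_union hd0 hmU (measure_ne_top _ _) (measure_ne_top _ _),
              measureReal_biUnion_finset hpd (fun i hi => (mP₁ i hi).diff (mP₀ i hi))
              (fun i _ => measure_ne_top _ _)]
        _ ≤ μ.real U₁ := measureReal_mono hsub (measure_ne_top _ _)
    -- `μ(D¹) + Σ ℓ_i ≤ μ(D⁰)`
    have hd : μ.real D₁ + ∑ i ∈ s, l i ≤ μ.real D₀ := by
      have hsub : D₁ ∪ ⋃ i ∈ s, (P₀ i \ P₁ i) ⊆ D₀ :=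
        Set.union_subset hD₁₀ (Set.iUnion₂_subset fun i hi ω h => (kP₀ i hi h).1)
      have hpd : (↑s : Set κ).PairwiseDisjoint fun i => P₀ i \ P₁ i :=
        fun i hi j hj hij => Set.disjoint_left.2 fun ω h1 h2 =>
          Set.disjoint_left.1 ((hdisj i (Finset.mem_coe.1 hi) j (Finset.mem_coe.1 hj) hij).preimage _) h1.1 h2.1
      have hd0 : Disjoint D₁ (⋃ i ∈ s, (P₀ i \ P₁ i)) := by
        refine Set.disjoint_left.2 fun ω h1 h2 => ?_
        simp only [Set.mem_iUnion, exists_prop] at h2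
        obtain ⟨i, hi, h3⟩ := h2
        exact (kP₀ i hi h3).2 h1
      have hmU : MeasurableSet (⋃ i ∈ s, (P₀ i \ P₁ i)) :=
        Finset.measurableSet_biUnion s fun i hi => (mP₀ i hi).diff (mP₁ i hi)
      calc μ.real D₁ + ∑ i ∈ s, l i
          = μ.real (D₁ ∪ ⋃ i ∈ s, (P₀ i \ P₁ i)) := by
            rw [measureReal_union hd0 hmU (measure_ne_top _ _) (measure_ne_top _ _),
              measureReal_biUnion_finset hpd (fun i hi => (mP₀ i hi).diff (mP₁ i hi))
              (fun i _ => measure_ne_top _ _)]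
        _ ≤ μ.real D₀ := measureReal_mono hsub (measure_ne_top _ _)
    -- one-coordinate decompositions
    have decU := real_eq_preimage_insert_add_preimage_sdiff p e dU
    have decD := real_eq_preimage_insert_add_preimage_sdiff p e dD
    have decM := real_eq_preimage_insert_add_preimage_sdiff p e (dU.inter dD)
    have eM₁ : insert e ⁻¹' (U ∩ D) = U₁ ∩ D₁ := rfl
    have eM₀ : (· \ {e}) ⁻¹' (U ∩ D) = U₀ ∩ D₀ := rfl
    rw [eM₁, eM₀] at decM
    have decP : ∀ i ∈ s, μ.real (P i) = p e * (w i + m i) + (1 - p e) * (w i + l i) := by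
      intro i hi
      rw [hμ, real_eq_preimage_insert_add_preimage_sdiff p e (dP i hi), ← hμ, ← hc₁ i hi, ← hc₀ i hi]
    have eS : ∑ i ∈ s, μ.real (P i) = ∑ i ∈ s, (p e * (w i + m i) + (1 - p e) * (w i + l i)) :=
      Finset.sum_congr rfl decP
    have eS2 : ∑ i ∈ s, μ.real (P i) ^ 2 = ∑ i ∈ s, (p e * (w i + m i) + (1 - p e) * (w i + l i)) ^ 2 :=
      Finset.sum_congr rfl fun i hi => by rw [decP i hi]
    have ih₁' : (∑ i ∈ s, (w i + m i)) ^ 2 - ∑ i ∈ s, (w i + m i) ^ 2 ≤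
        2 * (μ.real U₁ * μ.real D₁ - μ.real (U₁ ∩ D₁)) := by
      have e1 : ∑ i ∈ s, μ.real (P₁ i) = ∑ i ∈ s, (w i + m i) := Finset.sum_congr rfl hc₁
      have e2 : ∑ i ∈ s, μ.real (P₁ i) ^ 2 = ∑ i ∈ s, (w i + m i) ^ 2 :=
        Finset.sum_congr rfl fun i hi => by rw [hc₁ i hi]
      rw [← e1, ← e2]; exact ih₁
    have ih₀' : (∑ i ∈ s, (w i + l i)) ^ 2 - ∑ i ∈ s, (w i + l i) ^ 2 ≤
        2 * (μ.real U₀ * μ.real D₀ - μ.real (U₀ ∩ D₀)) := by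
      have e1 : ∑ i ∈ s, μ.real (P₀ i) = ∑ i ∈ s, (w i + l i) := Finset.sum_congr rfl hc₀
      have e2 : ∑ i ∈ s, μ.real (P₀ i) ^ 2 = ∑ i ∈ s, (w i + l i) ^ 2 :=
        Finset.sum_congr rfl fun i hi => by rw [hc₀ i hi]
      rw [← e1, ← e2]; exact ih₀
    rw [eS, eS2, hμ, decU, decD, decM, ← hμ]
    exact step_arith s (p e).2.1 (p e).2.2 (fun i _ => measureReal_nonneg) (fun i _ => measureReal_nonneg)
      hu hd ih₁' ih₀'

/-- **THEOREM (Gladkov's strong Harris–Kleitman inequality with a free region; cylinder-event form).**  For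
`μ = prodBernoulli p` on `Set ι`, an up-set `U`, a down-set `D`, and parts `P i ⊆ U ∩ D` (`i ∈ s`) that are pairwise
disjoint, pairwise incomparable and cover `U ∩ D`, all determined by a finite coordinate set `F`:
`(Σ_i μ(P i))² − Σ_i μ(P i)² ≤ 2 (μ(U) μ(D) − μ(U ∩ D))`. [this work] -/
theorem prodBernoulli_strongHarris_freeRegion_of_determinedBy (p : ι → unitInterval) {κ : Type*} (s : Finset κ)
    (F : Finset ι) {U D : Set (Set ι)} {P : κ → Set (Set ι)} (hU : IsUpperSet U) (hD : IsLowerSet D)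
    (hP : ∀ i ∈ s, P i ⊆ U ∩ D) (hdisj : ∀ i ∈ s, ∀ j ∈ s, i ≠ j → Disjoint (P i) (P j))
    (hcov : ∀ ω ∈ U ∩ D, ∃ i ∈ s, ω ∈ P i)
    (hinc : ∀ i ∈ s, ∀ j ∈ s, i ≠ j → ∀ ω ∈ P i, ∀ ω' ∈ P j, ¬ ω ⊆ ω')
    (dU : DeterminedBy U (↑F : Set ι)) (dD : DeterminedBy D (↑F : Set ι))
    (dP : ∀ i ∈ s, DeterminedBy (P i) (↑F : Set ι)) :
    (∑ i ∈ s, (prodBernoulli p).real (P i)) ^ 2 - ∑ i ∈ s, (prodBernoulli p).real (P i) ^ 2 ≤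
      2 * ((prodBernoulli p).real U * (prodBernoulli p).real D - (prodBernoulli p).real (U ∩ D)) := by
  classical
  exact core p s F U D P hU hD hP hdisj hcov hinc dU dD dP

/-- **THEOREM (Gladkov's strong Harris–Kleitman inequality with a free region; finite index type).**  For
`μ = prodBernoulli p` on `Set ι`, `ι` finite: if `U` is closed upwards, `D` closed downwards, and `U ∩ D` is covered by
pairwise disjoint, pairwise incomparable parts `P i ⊆ U ∩ D` (`i ∈ s`), then
`(Σ μ(P i))² − Σ μ(P i)² ≤ 2(μ(U) μ(D) − μ(U ∩ D))`, i.e. `μ(U) μ(D) ≥ μ(U ∩ D) + e₂(μ P)`. [this work] -/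
theorem prodBernoulli_strongHarris_freeRegion [Finite ι] (p : ι → unitInterval) {κ : Type*} (s : Finset κ)
    {U D : Set (Set ι)} {P : κ → Set (Set ι)} (hU : IsUpperSet U) (hD : IsLowerSet D)
    (hP : ∀ i ∈ s, P i ⊆ U ∩ D) (hdisj : ∀ i ∈ s, ∀ j ∈ s, i ≠ j → Disjoint (P i) (P j))
    (hcov : ∀ ω ∈ U ∩ D, ∃ i ∈ s, ω ∈ P i)
    (hinc : ∀ i ∈ s, ∀ j ∈ s, i ≠ j → ∀ ω ∈ P i, ∀ ω' ∈ P j, ¬ ω ⊆ ω') :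
    (∑ i ∈ s, (prodBernoulli p).real (P i)) ^ 2 - ∑ i ∈ s, (prodBernoulli p).real (P i) ^ 2 ≤
      2 * ((prodBernoulli p).real U * (prodBernoulli p).real D - (prodBernoulli p).real (U ∩ D)) := by
  classical
  haveI := Fintype.ofFinite ι
  have hall : ∀ X : Set (Set ι), DeterminedBy X (↑(Finset.univ : Finset ι) : Set ι) := fun X => by
    rw [determinedBy_iff]; intro ω ω' h; simp only [Finset.coe_univ, Set.inter_univ] at h; rw [h]
  exact prodBernoulli_strongHarris_freeRegion_of_determinedBy p s Finset.univ hU hD hP hdisj hcov hinc (hall U)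
    (hall D) fun i _ => hall (P i)

/-- **Ordered pair-sum form**: `Σ_{i} Σ_{j ≠ i} μ(P i) μ(P j) ≤ 2(μU μD − μ(U ∩ D))`.  (Gladkov's Theorem 2.1 itself — the
case `U = A ∪ ⋃ C i`, `D = Aᶜ`, where `μU μD − μ(U ∩ D) = μA μ((A ∪ ⋃ C i)ᶜ)` — is the tree's `prodBernoulli_strongHarris`
and is not restated here.) [this work] -/
theorem prodBernoulli_strongHarris_freeRegion_pairSum [Finite ι] (p : ι → unitInterval) {κ : Type*}
    [DecidableEq κ] (s : Finset κ) {U D : Set (Set ι)} {P : κ → Set (Set ι)} (hU : IsUpperSet U)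
    (hD : IsLowerSet D) (hP : ∀ i ∈ s, P i ⊆ U ∩ D) (hdisj : ∀ i ∈ s, ∀ j ∈ s, i ≠ j → Disjoint (P i) (P j))
    (hcov : ∀ ω ∈ U ∩ D, ∃ i ∈ s, ω ∈ P i)
    (hinc : ∀ i ∈ s, ∀ j ∈ s, i ≠ j → ∀ ω ∈ P i, ∀ ω' ∈ P j, ¬ ω ⊆ ω') :
    ∑ i ∈ s, ∑ j ∈ s.erase i, (prodBernoulli p).real (P i) * (prodBernoulli p).real (P j) ≤
      2 * ((prodBernoulli p).real U * (prodBernoulli p).real D - (prodBernoulli p).real (U ∩ D)) := by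
  have h := prodBernoulli_strongHarris_freeRegion p s hU hD hP hdisj hcov hinc
  have e : ∑ i ∈ s, ∑ j ∈ s.erase i, (prodBernoulli p).real (P i) * (prodBernoulli p).real (P j) =
      (∑ i ∈ s, (prodBernoulli p).real (P i)) ^ 2 - ∑ i ∈ s, (prodBernoulli p).real (P i) ^ 2 := by
    rw [sq, Finset.sum_mul_sum, ← Finset.sum_sub_distrib]
    refine Finset.sum_congr rfl fun i hi => ?_
    rw [← Finset.mul_sum, ← Finset.mul_sum, Finset.sum_erase_eq_sub hi, mul_sub, sq]
  rw [e]; exact h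

end StrongHarrisFreeRegion

end Summit.CriticalPhenomena.PercolationContinuityZ3.Theorems
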